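import Summits.QuantumFields.BalabanUV.Beta.FP.GradedIteratedDeriv
import Summits.QuantumFields.BalabanUV.Beta.FP.PerfectPropagatorSplit

/-!
# `BalabanUV.Beta.FP.MaxwellSymbolDeriv` — road «FP» for binder row D1, leaf H2-P of the horizontal route, row H2-P-REG (owner ruling R-FP-17), PART 2
# (WEIGHT-ABSTRACT half): along every coordinate slice `t ↦ update s i t` of the Brillouin zone the entries of the EXCESS weighted Maxwell matrix
# `maxwellMat (w − 1) p̂` are graded of ORDER 4 and those of the Feynman completion `feynMat w p̂` of ORDER 2 — `‖∂ᵢⁿ·(s)‖ ≤ K·‖s‖^{order−n}`, `n ≤ 3` —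
# for ANY weight family `w` whose slices are `C³` with `w − 1` graded of order 2 (the hypotheses the instance `w := Re W_∞` gets from W166-FLAT + W166-HOLO)

HONEST DEPENDENCY (page 1, mandatory): continuum YM on T⁴ ⇐ BetaPertH ∧ nine spine estimates (0/9 proved); BetaPertH ⇐ (D1) ∧ (D4) ∧ CAP+tail;
G-an2-4 gates asym, D1 and NE2/3/4.  HONEST FRAMING (cell contract, verbatim): «discharging `BetaPertH` makes Bałaban's UV stability UNCONDITIONAL —
a real constructive-QFT result; it is NOT the continuum limit and NOT the Clay problem.»  THIS MODULE DISCHARGES NOTHING of the wall: [folklore] one-variable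
calculus (PART 1 `FP/GradedIteratedDeriv`) applied to the explicit trigonometric structure of `PerfectPropagatorSymbol.curlRow/maxwellMat/feynMat` (p231001) at the
road's momentum factors `d1Sym s = (a ↦ e^{is_a} − 1)`.  The WEIGHT is ABSTRACT: every statement carries its slice regularity and graded bounds as DISPLAYED
hypotheses (`hwC`, `hw`); the instance `w := Re W_∞` is H2-P-REG's second half (after W166-HOLO).  0 def ∕ `def … : Prop` ∕ cite ∕ sorry; NOT D1 ∕ BetaPertH ∕ Clay.

ABSOLUTE RULE (cell charter, verbatim): «No internally-minted statement may enter as a cited fact. Every hypothesis is either kernel-proved in this package or a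
verbatim quotation of a PUBLISHED theorem with page reference. The manuscript(s) under audit are NOT citable for their own disputed steps — they are the thing
under adjudication; programme-internal (2001/route/tribunal) claims are never citable.»

CURRENCY.  `s : Fin d → ℝ` a base point, `i` a direction, slice `t ↦ Function.update s i t` (through `s` at `t = s i`); `‖s‖` = sup norm; «graded `(m, C)` at
`s i`» = `∀ n ≤ 3, ‖iteratedDeriv n (slice function) (s i)‖ ≤ C·‖s‖^{m−n}` (ℕ-truncated) = the `n`-th partial in direction `i` at `s`; `‖s‖ ≤ M`, `1 ≤ M`.
WEIGHT HYPOTHESES (per `μ ν`, at `s`, direction `i`): `hwC : ContDiff ℝ 3 (t ↦ ((w μ ν (update s i t) : ℝ) : ℂ))`, `hw :` the slice of `w − 1` graded `(2, cw)`.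
WHAT.  §1 atom slices (`d1Sym (update s i t) b = if b = i then e^{it} − 1 else d1Sym s b`, conjugate `e^{−i·} − 1`; graded `(1,1)`), curl rows graded `(1,2)`,
plaquette factor `conj(curlRow γ)·curlRow β` graded `(2, 32M²)`.  §2 **`graded_excess_entry`**: the slice of `maxwellMat (w − 1) (d1Sym ·) γ β` is `ContDiff ℝ 3`
and graded **`(4, 128·d²·M⁶·cw)`** — `‖∂ᵢⁿ R_{γβ}(s)‖ ≤ 128d²M⁶cw·‖s‖^{4−n}`, `n ≤ 3`.  §3 **`graded_feyn_entry`**: the slice of `feynMat w (d1Sym ·) γ β` is `ContDiff ℝ 3`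
and graded **`(2, 128·d²·M⁴·(M²cw + 1) + 8M²)`**.  §4 packaging for the consumers (H2-P-INV ∕ H2-P-B ∕ `PuncturedCoordDeriv`): `hasDerivAt_iteratedDeriv_slice`
(the chain `j ↦ iteratedDeriv j (G ∘ update s i)`, `j < 3`), `iteratedDeriv_slice_update` (base-point invariance), `update_insertNth` ∕ `slice_insertNth_eq`
(bridge to the `i.insertNth t q` slices).
Provenance: binder row G-an2-4 owner lineage gan24-p3, gen 16 (prover-b2b-balaban-gan24-p3-g16-0), 2026-08-20; supplier of road FP's H2-P-REG (owner
b2b-balaban-beta-d1-p3, R-FP-17).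
-/

noncomputable section

namespace Summit.QuantumFields.BalabanUV.Beta.FP.MaxwellSymbolDeriv

open Complex Finset
open scoped BigOperators ComplexConjugate
open Literature.MathematicalPhysics.QuantumFieldTheory.Balaban1983to89
open B5Prop11Fiber (d1Sym)
open Summit.QuantumFields.BalabanUV.Beta.FP.PerfectPropagatorSymbol (curlRow maxwellMat feynMat)
open Summit.QuantumFields.BalabanUV.Beta.FP.PerfectPropagatorSplit (maxwellMat_eq_sum)
open Summit.QuantumFields.BalabanUV.Beta.FP.GradedIteratedDeriv

variable {d : ℕ}

/-! ## §1 Slices of the atoms, curl rows, plaquette factors -/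

/-- [folklore] the momentum factor along a coordinate slice: only the `i`-th factor moves. -/
theorem d1Sym_update (s : Fin d → ℝ) (i : Fin d) (t : ℝ) (b : Fin d) :
    d1Sym (Function.update s i t) b = if b = i then cexp ((t : ℂ) * I) - 1 else d1Sym s b := by
  unfold d1Sym
  by_cases h : b = i
  · subst h; simp
  · simp [h]

/-- [folklore] the slice FUNCTION of the momentum factor. -/
theorem d1Sym_slice_eq (s : Fin d → ℝ) (i b : Fin d) :
    (fun t : ℝ => d1Sym (Function.update s i t) b) = if b = i then (fun t : ℝ => cexp ((t : ℂ) * I) - 1) else fun _ => d1Sym s b := by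
  funext t; rw [d1Sym_update]; split_ifs <;> rfl

/-- [folklore] conjugate of the momentum factor: `conj(e^{is_b} − 1) = e^{−is_b} − 1`. -/
theorem conj_d1Sym (s : Fin d → ℝ) (b : Fin d) : conj (d1Sym s b) = cexp (-((s b : ℂ) * I)) - 1 := by
  unfold d1Sym
  rw [map_sub, map_one, ← Complex.exp_conj, map_mul, Complex.conj_ofReal, Complex.conj_I]
  ring_nf

/-- [folklore] the slice FUNCTION of the conjugate momentum factor. -/
theorem conj_d1Sym_slice_eq (s : Fin d → ℝ) (i b : Fin d) :
    (fun t : ℝ => conj (d1Sym (Function.update s i t) b))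
      = if b = i then (fun t : ℝ => cexp (-((t : ℂ) * I)) - 1) else fun _ => conj (d1Sym s b) := by
  funext t
  rw [d1Sym_update]
  by_cases h : b = i
  · rw [if_pos h, if_pos h, map_sub, map_one, ← Complex.exp_conj, map_mul, Complex.conj_ofReal, Complex.conj_I]; ring_nf
  · rw [if_neg h, if_neg h]

/-- [folklore] `‖e^{is_b} − 1‖ ≤ ‖s‖` (chord bound + `|s_b| ≤ ‖s‖`). -/
theorem norm_d1Sym_le_norm (s : Fin d → ℝ) (b : Fin d) : ‖d1Sym s b‖ ≤ ‖s‖ := by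
  have h := Real.norm_exp_I_mul_ofReal_sub_one_le (x := s b)
  rw [mul_comm] at h
  exact h.trans (norm_le_pi_norm s b)

/-- [folklore] the atom slice is `ContDiff ℝ 3`. -/
theorem contDiff_d1Sym_slice (s : Fin d → ℝ) (i b : Fin d) : ContDiff ℝ 3 (fun t : ℝ => d1Sym (Function.update s i t) b) := by
  rw [d1Sym_slice_eq]
  split_ifs
  · exact contDiff_expSub
  · exact contDiff_const

/-- [folklore] the conjugate atom slice is `ContDiff ℝ 3`. -/
theorem contDiff_conj_d1Sym_slice (s : Fin d → ℝ) (i b : Fin d) : ContDiff ℝ 3 (fun t : ℝ => conj (d1Sym (Function.update s i t) b)) := by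
  rw [conj_d1Sym_slice_eq]
  split_ifs
  · exact contDiff_expNegSub
  · exact contDiff_const

/-- [folklore] **THE ATOM SLICE IS GRADED `(1, 1)`** at `s i` with scale `‖s‖`. -/
theorem graded_d1Sym_slice (s : Fin d → ℝ) (i b : Fin d) :
    ∀ n ≤ 3, ‖iteratedDeriv n (fun t : ℝ => d1Sym (Function.update s i t) b) (s i)‖ ≤ 1 * ‖s‖ ^ (1 - n) := by
  rw [d1Sym_slice_eq]
  split_ifs with h
  · exact graded_expSub (by rw [← Real.norm_eq_abs]; exact norm_le_pi_norm s i)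
  · exact graded_const _ zero_le_one (norm_nonneg _) (by rw [pow_one, one_mul]; exact norm_d1Sym_le_norm s b) (s i)

/-- [folklore] **THE CONJUGATE ATOM SLICE IS GRADED `(1, 1)`**. -/
theorem graded_conj_d1Sym_slice (s : Fin d → ℝ) (i b : Fin d) :
    ∀ n ≤ 3, ‖iteratedDeriv n (fun t : ℝ => conj (d1Sym (Function.update s i t) b)) (s i)‖ ≤ 1 * ‖s‖ ^ (1 - n) := by
  rw [conj_d1Sym_slice_eq]
  split_ifs with h
  · exact graded_expNegSub (by rw [← Real.norm_eq_abs]; exact norm_le_pi_norm s i)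
  · exact graded_const _ zero_le_one (norm_nonneg _)
      (by rw [pow_one, one_mul, Complex.norm_conj]; exact norm_d1Sym_le_norm s b) (s i)

/-- [folklore] the curl row along the slice as a combination of atoms. -/
theorem curlRow_slice_eq (s : Fin d → ℝ) (i μ ν β : Fin d) :
    (fun t : ℝ => curlRow (d1Sym (Function.update s i t)) μ ν β)
      = fun t => (if β = ν then (1 : ℂ) else 0) * d1Sym (Function.update s i t) μ + (if β = μ then (-1 : ℂ) else 0) * d1Sym (Function.update s i t) ν := by
  funext t; unfold curlRow; split_ifs <;> ring

/-- [folklore] the conjugate curl row along the slice. -/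
theorem conj_curlRow_slice_eq (s : Fin d → ℝ) (i μ ν γ : Fin d) :
    (fun t : ℝ => conj (curlRow (d1Sym (Function.update s i t)) μ ν γ))
      = fun t => (if γ = ν then (1 : ℂ) else 0) * conj (d1Sym (Function.update s i t) μ)
          + (if γ = μ then (-1 : ℂ) else 0) * conj (d1Sym (Function.update s i t) ν) := by
  funext t; unfold curlRow; split_ifs <;> (simp; try ring)

/-- [folklore] an indicator coefficient has norm `≤ 1`. -/
theorem norm_ite_le_one (p : Prop) [Decidable p] (c : ℂ) (hc : ‖c‖ ≤ 1) : ‖(if p then c else 0)‖ ≤ 1 := by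
  split_ifs <;> simp [hc]

/-- [folklore] the curl-row slice is `ContDiff ℝ 3`. -/
theorem contDiff_curlRow_slice (s : Fin d → ℝ) (i μ ν β : Fin d) :
    ContDiff ℝ 3 (fun t : ℝ => curlRow (d1Sym (Function.update s i t)) μ ν β) := by
  rw [curlRow_slice_eq]
  exact (contDiff_const.mul (contDiff_d1Sym_slice s i μ)).add (contDiff_const.mul (contDiff_d1Sym_slice s i ν))

/-- [folklore] the conjugate curl-row slice is `ContDiff ℝ 3`. -/
theorem contDiff_conj_curlRow_slice (s : Fin d → ℝ) (i μ ν γ : Fin d) :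
    ContDiff ℝ 3 (fun t : ℝ => conj (curlRow (d1Sym (Function.update s i t)) μ ν γ)) := by
  rw [conj_curlRow_slice_eq]
  exact (contDiff_const.mul (contDiff_conj_d1Sym_slice s i μ)).add (contDiff_const.mul (contDiff_conj_d1Sym_slice s i ν))

/-- [folklore] **THE CURL-ROW SLICE IS GRADED `(1, 2)`.** -/
theorem graded_curlRow_slice (s : Fin d → ℝ) (i μ ν β : Fin d) :
    ∀ n ≤ 3, ‖iteratedDeriv n (fun t : ℝ => curlRow (d1Sym (Function.update s i t)) μ ν β) (s i)‖ ≤ 2 * ‖s‖ ^ (1 - n) := by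
  rw [curlRow_slice_eq]
  have hρ : 0 ≤ ‖s‖ := norm_nonneg s
  have h1 := graded_mono (graded_const_mul (contDiff_d1Sym_slice s i μ) (graded_d1Sym_slice s i μ) (if β = ν then (1 : ℂ) else 0))
    (show ‖(if β = ν then (1 : ℂ) else 0)‖ * 1 ≤ 1 by rw [mul_one]; exact norm_ite_le_one _ 1 (by simp)) hρ
  have h2 := graded_mono (graded_const_mul (contDiff_d1Sym_slice s i ν) (graded_d1Sym_slice s i ν) (if β = μ then (-1 : ℂ) else 0))
    (show ‖(if β = μ then (-1 : ℂ) else 0)‖ * 1 ≤ 1 by rw [mul_one]; exact norm_ite_le_one _ (-1) (by simp)) hρ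
  have h := graded_add (contDiff_const.mul (contDiff_d1Sym_slice s i μ)) (contDiff_const.mul (contDiff_d1Sym_slice s i ν)) h1 h2
  intro n hn
  calc _ ≤ (1 + 1) * ‖s‖ ^ (1 - n) := h n hn
    _ = 2 * ‖s‖ ^ (1 - n) := by norm_num

/-- [folklore] **THE CONJUGATE CURL-ROW SLICE IS GRADED `(1, 2)`.** -/
theorem graded_conj_curlRow_slice (s : Fin d → ℝ) (i μ ν γ : Fin d) :
    ∀ n ≤ 3, ‖iteratedDeriv n (fun t : ℝ => conj (curlRow (d1Sym (Function.update s i t)) μ ν γ)) (s i)‖ ≤ 2 * ‖s‖ ^ (1 - n) := by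
  rw [conj_curlRow_slice_eq]
  have hρ : 0 ≤ ‖s‖ := norm_nonneg s
  have h1 := graded_mono (graded_const_mul (contDiff_conj_d1Sym_slice s i μ) (graded_conj_d1Sym_slice s i μ) (if γ = ν then (1 : ℂ) else 0))
    (show ‖(if γ = ν then (1 : ℂ) else 0)‖ * 1 ≤ 1 by rw [mul_one]; exact norm_ite_le_one _ 1 (by simp)) hρ
  have h2 := graded_mono (graded_const_mul (contDiff_conj_d1Sym_slice s i ν) (graded_conj_d1Sym_slice s i ν) (if γ = μ then (-1 : ℂ) else 0))
    (show ‖(if γ = μ then (-1 : ℂ) else 0)‖ * 1 ≤ 1 by rw [mul_one]; exact norm_ite_le_one _ (-1) (by simp)) hρ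
  have h := graded_add (contDiff_const.mul (contDiff_conj_d1Sym_slice s i μ)) (contDiff_const.mul (contDiff_conj_d1Sym_slice s i ν)) h1 h2
  intro n hn
  calc _ ≤ (1 + 1) * ‖s‖ ^ (1 - n) := h n hn
    _ = 2 * ‖s‖ ^ (1 - n) := by norm_num

/-- [folklore] the plaquette factor slice `conj(curlRow γ)·curlRow β` is `ContDiff ℝ 3`. -/
theorem contDiff_plaq_slice (s : Fin d → ℝ) (i μ ν γ β : Fin d) :
    ContDiff ℝ 3 (fun t : ℝ => conj (curlRow (d1Sym (Function.update s i t)) μ ν γ) * curlRow (d1Sym (Function.update s i t)) μ ν β) :=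
  (contDiff_conj_curlRow_slice s i μ ν γ).mul (contDiff_curlRow_slice s i μ ν β)

/-- [folklore] **THE PLAQUETTE FACTOR SLICE IS GRADED `(2, 32M²)`** (`‖s‖ ≤ M`, `1 ≤ M`). -/
theorem graded_plaq_slice (s : Fin d → ℝ) (i μ ν γ β : Fin d) {M : ℝ} (hsM : ‖s‖ ≤ M) (hM : 1 ≤ M) :
    ∀ n ≤ 3, ‖iteratedDeriv n (fun t : ℝ => conj (curlRow (d1Sym (Function.update s i t)) μ ν γ) * curlRow (d1Sym (Function.update s i t)) μ ν β) (s i)‖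
      ≤ 32 * M ^ 2 * ‖s‖ ^ (2 - n) := by
  have h := graded_mul (contDiff_conj_curlRow_slice s i μ ν γ) (contDiff_curlRow_slice s i μ ν β) (by norm_num) (by norm_num)
    (graded_conj_curlRow_slice s i μ ν γ) (graded_curlRow_slice s i μ ν β) (norm_nonneg s) hsM hM
  intro n hn
  have := h n hn
  calc _ ≤ 8 * M ^ (1 + 1) * 2 * 2 * ‖s‖ ^ (1 + 1 - n) := this
    _ = 32 * M ^ 2 * ‖s‖ ^ (2 - n) := by rw [show (1 + 1 : ℕ) = 2 from rfl]; ring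

/-! ## §2 The excess weighted Maxwell entry along a slice: ORDER 4 -/

section Weight

variable (w : Fin d → Fin d → (Fin d → ℝ) → ℝ) (s : Fin d → ℝ) (i : Fin d) {cw M : ℝ}

/-- [folklore] the excess entry along the slice as an if-free double sum of (½)·(w − 1)·(plaquette factor). -/
theorem excess_slice_eq (γ β : Fin d) :
    (fun t : ℝ => maxwellMat (fun μ ν => w μ ν (Function.update s i t) - 1) (d1Sym (Function.update s i t)) γ β)
      = fun t => ∑ μ, ∑ ν, (1 / 2 : ℂ) * ((((w μ ν (Function.update s i t) : ℝ) : ℂ) - 1)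
          * (conj (curlRow (d1Sym (Function.update s i t)) μ ν γ) * curlRow (d1Sym (Function.update s i t)) μ ν β)) := by
  funext t
  rw [maxwellMat_eq_sum]
  refine Finset.sum_congr rfl fun μ _ => Finset.sum_congr rfl fun ν _ => ?_
  push_cast; ring

/-- [folklore] one plaquette term of the excess entry is `ContDiff ℝ 3` (weight slice `C³`). -/
theorem contDiff_excess_term (hwC : ∀ μ ν, ContDiff ℝ 3 (fun t : ℝ => ((w μ ν (Function.update s i t) : ℝ) : ℂ))) (μ ν γ β : Fin d) :
    ContDiff ℝ 3 (fun t : ℝ => (1 / 2 : ℂ) * ((((w μ ν (Function.update s i t) : ℝ) : ℂ) - 1)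
      * (conj (curlRow (d1Sym (Function.update s i t)) μ ν γ) * curlRow (d1Sym (Function.update s i t)) μ ν β))) :=
  contDiff_const.mul (((hwC μ ν).sub contDiff_const).mul (contDiff_plaq_slice s i μ ν γ β))

/-- [folklore] **THE EXCESS ENTRY SLICE IS `ContDiff ℝ 3`.** -/
theorem contDiff_excess_entry (hwC : ∀ μ ν, ContDiff ℝ 3 (fun t : ℝ => ((w μ ν (Function.update s i t) : ℝ) : ℂ))) (γ β : Fin d) :
    ContDiff ℝ 3 (fun t : ℝ => maxwellMat (fun μ ν => w μ ν (Function.update s i t) - 1) (d1Sym (Function.update s i t)) γ β) := by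
  rw [excess_slice_eq]
  exact ContDiff.sum fun μ _ => ContDiff.sum fun ν _ => contDiff_excess_term w s i hwC μ ν γ β

/-- [folklore] one plaquette term of the excess entry is graded `(4, 128·M⁶·cw)`. -/
theorem graded_excess_term (hwC : ∀ μ ν, ContDiff ℝ 3 (fun t : ℝ => ((w μ ν (Function.update s i t) : ℝ) : ℂ)))
    (hcw : 0 ≤ cw) (hw : ∀ μ ν, ∀ n ≤ 3, ‖iteratedDeriv n (fun t : ℝ => ((w μ ν (Function.update s i t) : ℝ) : ℂ) - 1) (s i)‖ ≤ cw * ‖s‖ ^ (2 - n))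
    (hsM : ‖s‖ ≤ M) (hM : 1 ≤ M) (μ ν γ β : Fin d) :
    ∀ n ≤ 3, ‖iteratedDeriv n (fun t : ℝ => (1 / 2 : ℂ) * ((((w μ ν (Function.update s i t) : ℝ) : ℂ) - 1)
      * (conj (curlRow (d1Sym (Function.update s i t)) μ ν γ) * curlRow (d1Sym (Function.update s i t)) μ ν β))) (s i)‖
        ≤ 128 * M ^ 6 * cw * ‖s‖ ^ (4 - n) := by
  have hM0 : 0 ≤ M := zero_le_one.trans hM
  have hwC' : ContDiff ℝ 3 (fun t : ℝ => ((w μ ν (Function.update s i t) : ℝ) : ℂ) - 1) := (hwC μ ν).sub contDiff_const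
  have hprod := graded_mul hwC' (contDiff_plaq_slice s i μ ν γ β) hcw (by positivity) (hw μ ν) (graded_plaq_slice s i μ ν γ β hsM hM)
    (norm_nonneg s) hsM hM
  have h := graded_const_mul (hwC'.mul (contDiff_plaq_slice s i μ ν γ β)) hprod (1 / 2 : ℂ)
  intro n hn
  have := h n hn
  have e : ‖(1 / 2 : ℂ)‖ = 1 / 2 := by simp
  calc _ ≤ ‖(1 / 2 : ℂ)‖ * (8 * M ^ (2 + 2) * cw * (32 * M ^ 2)) * ‖s‖ ^ (2 + 2 - n) := this
    _ = 128 * M ^ 6 * cw * ‖s‖ ^ (4 - n) := by rw [e, show (2 + 2 : ℕ) = 4 from rfl]; ring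

/-- [our object] **THE EXCESS WEIGHTED MAXWELL ENTRY IS GRADED OF ORDER 4 ALONG EVERY SLICE**: for a weight family whose slices through `s` in direction
`i` are `C³` with `w − 1` graded `(2, cw)`, and `‖s‖ ≤ M`, `1 ≤ M`:
`‖∂ᵢⁿ [maxwellMat (w − 1) (p̂)]_{γβ} (s)‖ ≤ 128·d²·M⁶·cw · ‖s‖^{4−n}` for `n ≤ 3` (the `A`-data of H2-P-B: `R = O(|s|⁴)` with graded derivatives). -/
theorem graded_excess_entry (hwC : ∀ μ ν, ContDiff ℝ 3 (fun t : ℝ => ((w μ ν (Function.update s i t) : ℝ) : ℂ)))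
    (hcw : 0 ≤ cw) (hw : ∀ μ ν, ∀ n ≤ 3, ‖iteratedDeriv n (fun t : ℝ => ((w μ ν (Function.update s i t) : ℝ) : ℂ) - 1) (s i)‖ ≤ cw * ‖s‖ ^ (2 - n))
    (hsM : ‖s‖ ≤ M) (hM : 1 ≤ M) (γ β : Fin d) :
    ∀ n ≤ 3, ‖iteratedDeriv n (fun t : ℝ => maxwellMat (fun μ ν => w μ ν (Function.update s i t) - 1) (d1Sym (Function.update s i t)) γ β) (s i)‖
      ≤ 128 * d ^ 2 * M ^ 6 * cw * ‖s‖ ^ (4 - n) := by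
  rw [excess_slice_eq]
  have hinner : ∀ μ : Fin d, ∀ n ≤ 3, ‖iteratedDeriv n (fun t : ℝ => ∑ ν, (1 / 2 : ℂ) * ((((w μ ν (Function.update s i t) : ℝ) : ℂ) - 1)
      * (conj (curlRow (d1Sym (Function.update s i t)) μ ν γ) * curlRow (d1Sym (Function.update s i t)) μ ν β))) (s i)‖
        ≤ (∑ _ν : Fin d, 128 * M ^ 6 * cw) * ‖s‖ ^ (4 - n) :=
    fun μ => graded_sum (Finset.univ : Finset (Fin d)) (fun ν _ => contDiff_excess_term w s i hwC μ ν γ β)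
      (fun ν _ => graded_excess_term w s i hwC hcw hw hsM hM μ ν γ β)
  have h := graded_sum (Finset.univ : Finset (Fin d)) (fun μ _ => ContDiff.sum fun ν _ => contDiff_excess_term w s i hwC μ ν γ β) (fun μ _ => hinner μ)
  intro n hn
  refine (h n hn).trans (le_of_eq ?_)
  simp only [Finset.sum_const, Finset.card_univ, Fintype.card_fin, nsmul_eq_mul]
  ring

end Weight

/-! ## §3 The Feynman-completed entry along a slice: ORDER 2 -/

section Feyn

variable (w : Fin d → Fin d → (Fin d → ℝ) → ℝ) (s : Fin d → ℝ) (i : Fin d) {cw M : ℝ}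

/-- [folklore] the Feynman-completed entry along the slice as an if-free double sum plus the slice term. -/
theorem feyn_slice_eq (γ β : Fin d) :
    (fun t : ℝ => feynMat (fun μ ν => w μ ν (Function.update s i t)) (d1Sym (Function.update s i t)) γ β)
      = fun t => (∑ μ, ∑ ν, (1 / 2 : ℂ) * ((((w μ ν (Function.update s i t) : ℝ) : ℂ))
          * (conj (curlRow (d1Sym (Function.update s i t)) μ ν γ) * curlRow (d1Sym (Function.update s i t)) μ ν β)))
          + d1Sym (Function.update s i t) γ * conj (d1Sym (Function.update s i t) β) := by
  funext t
  unfold feynMat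
  rw [maxwellMat_eq_sum]
  congr 1
  refine Finset.sum_congr rfl fun μ _ => Finset.sum_congr rfl fun ν _ => ?_
  push_cast; ring

/-- [folklore] the weight slice ITSELF is graded `(0, M²cw + 1)` when `w − 1` is graded `(2, cw)`. -/
theorem graded_weight_slice (hwC : ∀ μ ν, ContDiff ℝ 3 (fun t : ℝ => ((w μ ν (Function.update s i t) : ℝ) : ℂ)))
    (hcw : 0 ≤ cw) (hw : ∀ μ ν, ∀ n ≤ 3, ‖iteratedDeriv n (fun t : ℝ => ((w μ ν (Function.update s i t) : ℝ) : ℂ) - 1) (s i)‖ ≤ cw * ‖s‖ ^ (2 - n))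
    (hsM : ‖s‖ ≤ M) (hM : 1 ≤ M) (μ ν : Fin d) :
    ∀ n ≤ 3, ‖iteratedDeriv n (fun t : ℝ => ((w μ ν (Function.update s i t) : ℝ) : ℂ)) (s i)‖ ≤ (M ^ 2 * cw + 1) * ‖s‖ ^ (0 - n) := by
  have h1 := graded_of_le_order (hw μ ν) hcw (Nat.zero_le 2) (norm_nonneg s) hsM hM
  have h2 := graded_const (1 : ℂ) zero_le_one (norm_nonneg s) (by simp : ‖(1 : ℂ)‖ ≤ 1 * ‖s‖ ^ 0) (s i)
  have h := graded_add ((hwC μ ν).sub contDiff_const) contDiff_const h1 h2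
  have e : (fun t : ℝ => (((w μ ν (Function.update s i t) : ℝ) : ℂ) - 1) + (1 : ℂ)) = fun t : ℝ => ((w μ ν (Function.update s i t) : ℝ) : ℂ) := by
    funext t; ring
  rw [e] at h
  simpa using h

/-- [folklore] one plaquette term of the Feynman entry is `ContDiff ℝ 3`. -/
theorem contDiff_feyn_term (hwC : ∀ μ ν, ContDiff ℝ 3 (fun t : ℝ => ((w μ ν (Function.update s i t) : ℝ) : ℂ))) (μ ν γ β : Fin d) :
    ContDiff ℝ 3 (fun t : ℝ => (1 / 2 : ℂ) * ((((w μ ν (Function.update s i t) : ℝ) : ℂ))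
      * (conj (curlRow (d1Sym (Function.update s i t)) μ ν γ) * curlRow (d1Sym (Function.update s i t)) μ ν β))) :=
  contDiff_const.mul ((hwC μ ν).mul (contDiff_plaq_slice s i μ ν γ β))

/-- [folklore] the slice term `p̂_γ·conj(p̂_β)` is `ContDiff ℝ 3`. -/
theorem contDiff_slice_term (γ β : Fin d) :
    ContDiff ℝ 3 (fun t : ℝ => d1Sym (Function.update s i t) γ * conj (d1Sym (Function.update s i t) β)) :=
  (contDiff_d1Sym_slice s i γ).mul (contDiff_conj_d1Sym_slice s i β)

/-- [folklore] **THE FEYNMAN ENTRY SLICE IS `ContDiff ℝ 3`.** -/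
theorem contDiff_feyn_entry (hwC : ∀ μ ν, ContDiff ℝ 3 (fun t : ℝ => ((w μ ν (Function.update s i t) : ℝ) : ℂ))) (γ β : Fin d) :
    ContDiff ℝ 3 (fun t : ℝ => feynMat (fun μ ν => w μ ν (Function.update s i t)) (d1Sym (Function.update s i t)) γ β) := by
  rw [feyn_slice_eq]
  exact (ContDiff.sum fun μ _ => ContDiff.sum fun ν _ => contDiff_feyn_term w s i hwC μ ν γ β).add (contDiff_slice_term s i γ β)

/-- [folklore] one plaquette term of the Feynman entry is graded `(2, 128·M⁴·(M²cw + 1))`. -/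
theorem graded_feyn_term (hwC : ∀ μ ν, ContDiff ℝ 3 (fun t : ℝ => ((w μ ν (Function.update s i t) : ℝ) : ℂ)))
    (hcw : 0 ≤ cw) (hw : ∀ μ ν, ∀ n ≤ 3, ‖iteratedDeriv n (fun t : ℝ => ((w μ ν (Function.update s i t) : ℝ) : ℂ) - 1) (s i)‖ ≤ cw * ‖s‖ ^ (2 - n))
    (hsM : ‖s‖ ≤ M) (hM : 1 ≤ M) (μ ν γ β : Fin d) :
    ∀ n ≤ 3, ‖iteratedDeriv n (fun t : ℝ => (1 / 2 : ℂ) * ((((w μ ν (Function.update s i t) : ℝ) : ℂ))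
      * (conj (curlRow (d1Sym (Function.update s i t)) μ ν γ) * curlRow (d1Sym (Function.update s i t)) μ ν β))) (s i)‖
        ≤ 128 * M ^ 4 * (M ^ 2 * cw + 1) * ‖s‖ ^ (2 - n) := by
  have hM0 : 0 ≤ M := zero_le_one.trans hM
  have hprod := graded_mul (hwC μ ν) (contDiff_plaq_slice s i μ ν γ β) (by positivity) (by positivity)
    (graded_weight_slice w s i hwC hcw hw hsM hM μ ν) (graded_plaq_slice s i μ ν γ β hsM hM) (norm_nonneg s) hsM hM
  have h := graded_const_mul ((hwC μ ν).mul (contDiff_plaq_slice s i μ ν γ β)) hprod (1 / 2 : ℂ)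
  intro n hn
  have := h n hn
  have e : ‖(1 / 2 : ℂ)‖ = 1 / 2 := by simp
  calc _ ≤ ‖(1 / 2 : ℂ)‖ * (8 * M ^ (0 + 2) * (M ^ 2 * cw + 1) * (32 * M ^ 2)) * ‖s‖ ^ (0 + 2 - n) := this
    _ = 128 * M ^ 4 * (M ^ 2 * cw + 1) * ‖s‖ ^ (2 - n) := by rw [e, show (0 + 2 : ℕ) = 2 from rfl]; ring

/-- [folklore] the slice term `p̂_γ·conj(p̂_β)` is graded `(2, 8M²)`. -/
theorem graded_slice_term (hsM : ‖s‖ ≤ M) (hM : 1 ≤ M) (γ β : Fin d) :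
    ∀ n ≤ 3, ‖iteratedDeriv n (fun t : ℝ => d1Sym (Function.update s i t) γ * conj (d1Sym (Function.update s i t) β)) (s i)‖ ≤ 8 * M ^ 2 * ‖s‖ ^ (2 - n) := by
  have h := graded_mul (contDiff_d1Sym_slice s i γ) (contDiff_conj_d1Sym_slice s i β) zero_le_one zero_le_one
    (graded_d1Sym_slice s i γ) (graded_conj_d1Sym_slice s i β) (norm_nonneg s) hsM hM
  intro n hn
  have := h n hn
  calc _ ≤ 8 * M ^ (1 + 1) * 1 * 1 * ‖s‖ ^ (1 + 1 - n) := this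
    _ = 8 * M ^ 2 * ‖s‖ ^ (2 - n) := by rw [show (1 + 1 : ℕ) = 2 from rfl]; ring

/-- [our object] **THE FEYNMAN-COMPLETED WEIGHTED MAXWELL ENTRY IS GRADED OF ORDER 2 ALONG EVERY SLICE**: under the same weight hypotheses,
`‖∂ᵢⁿ [feynMat w (p̂)]_{γβ} (s)‖ ≤ (128·d²·M⁴·(M²cw + 1) + 8M²) · ‖s‖^{2−n}` for `n ≤ 3` (the `A, A₁, A₂, A₃` data of H2-P-INV-BND in entry currency). -/
theorem graded_feyn_entry (hwC : ∀ μ ν, ContDiff ℝ 3 (fun t : ℝ => ((w μ ν (Function.update s i t) : ℝ) : ℂ)))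
    (hcw : 0 ≤ cw) (hw : ∀ μ ν, ∀ n ≤ 3, ‖iteratedDeriv n (fun t : ℝ => ((w μ ν (Function.update s i t) : ℝ) : ℂ) - 1) (s i)‖ ≤ cw * ‖s‖ ^ (2 - n))
    (hsM : ‖s‖ ≤ M) (hM : 1 ≤ M) (γ β : Fin d) :
    ∀ n ≤ 3, ‖iteratedDeriv n (fun t : ℝ => feynMat (fun μ ν => w μ ν (Function.update s i t)) (d1Sym (Function.update s i t)) γ β) (s i)‖
      ≤ (128 * d ^ 2 * M ^ 4 * (M ^ 2 * cw + 1) + 8 * M ^ 2) * ‖s‖ ^ (2 - n) := by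
  rw [feyn_slice_eq]
  have hinner : ∀ μ : Fin d, ∀ n ≤ 3, ‖iteratedDeriv n (fun t : ℝ => ∑ ν, (1 / 2 : ℂ) * ((((w μ ν (Function.update s i t) : ℝ) : ℂ))
      * (conj (curlRow (d1Sym (Function.update s i t)) μ ν γ) * curlRow (d1Sym (Function.update s i t)) μ ν β))) (s i)‖
        ≤ (∑ _ν : Fin d, 128 * M ^ 4 * (M ^ 2 * cw + 1)) * ‖s‖ ^ (2 - n) :=
    fun μ => graded_sum (Finset.univ : Finset (Fin d)) (fun ν _ => contDiff_feyn_term w s i hwC μ ν γ β)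
      (fun ν _ => graded_feyn_term w s i hwC hcw hw hsM hM μ ν γ β)
  have hS := graded_sum (Finset.univ : Finset (Fin d)) (fun μ _ => ContDiff.sum fun ν _ => contDiff_feyn_term w s i hwC μ ν γ β) (fun μ _ => hinner μ)
  have h := graded_add (ContDiff.sum fun μ _ => ContDiff.sum fun ν _ => contDiff_feyn_term w s i hwC μ ν γ β) (contDiff_slice_term s i γ β)
    hS (graded_slice_term s i hsM hM γ β)
  intro n hn
  refine (h n hn).trans (le_of_eq ?_)
  simp only [Finset.sum_const, Finset.card_univ, Fintype.card_fin, nsmul_eq_mul]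
  ring

end Feyn

/-! ## §4 Packaging: the derivative chain along a slice and base-point invariance -/

/-- [folklore] **THE CHAIN**: if the slice `t ↦ G (update s i t)` is `ContDiff ℝ 3` then for `j < 3` the `j`-th slice derivative has the `(j+1)`-st as its
derivative at every `t` (the `hder` data of `PuncturedCoordDeriv` ∕ the `A_j` data of `MatrixInvDeriv`, in `iteratedDeriv` form). -/
theorem hasDerivAt_iteratedDeriv_slice {G : (Fin d → ℝ) → ℂ} {s : Fin d → ℝ} {i : Fin d}
    (hG : ContDiff ℝ 3 (fun t : ℝ => G (Function.update s i t))) {j : ℕ} (hj : j < 3) (t : ℝ) :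
    HasDerivAt (iteratedDeriv j (fun u : ℝ => G (Function.update s i u)))
      (iteratedDeriv (j + 1) (fun u : ℝ => G (Function.update s i u)) t) t := by
  have hdiff := ContDiff.differentiable_iteratedDeriv j hG (by exact_mod_cast hj)
  rw [iteratedDeriv_succ]
  exact (hdiff t).hasDerivAt

/-- [folklore] **BASE-POINT INVARIANCE**: the slice through `update s i t` in direction `i` IS the slice through `s`; hence a «partial-derivative symbol»
`F_j(s) := iteratedDeriv j (G ∘ update s i) (s i)` read along the slice is the chain of the slice: `F_j (update s i t) = iteratedDeriv j (G ∘ update s i) t`. -/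
theorem iteratedDeriv_slice_update (G : (Fin d → ℝ) → ℂ) (s : Fin d → ℝ) (i : Fin d) (j : ℕ) (t : ℝ) :
    iteratedDeriv j (fun u : ℝ => G (Function.update (Function.update s i t) i u)) ((Function.update s i t) i)
      = iteratedDeriv j (fun u : ℝ => G (Function.update s i u)) t := by
  have e : (fun u : ℝ => G (Function.update (Function.update s i t) i u)) = fun u : ℝ => G (Function.update s i u) := by
    funext u; rw [Function.update_idem]
  rw [e, Function.update_self]

/-- [folklore] the sup norm of a slice point dominates the running coordinate: `|t| ≤ ‖update s i t‖`. -/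
theorem abs_le_norm_update (s : Fin d → ℝ) (i : Fin d) (t : ℝ) : |t| ≤ ‖Function.update s i t‖ := by
  have h := norm_le_pi_norm (Function.update s i t) i
  rwa [Function.update_self, Real.norm_eq_abs] at h


/-- [folklore] BRIDGE TO THE `insertNth` SLICES of `PuncturedCoordDeriv` ∕ H2-P-B: `update (i.insertNth t₀ q) i t = i.insertNth t q`, so the slice through
`s := i.insertNth t₀ q` in direction `i` of this file IS the slice `t ↦ i.insertNth t q`. -/
theorem update_insertNth {n : ℕ} (i : Fin (n + 1)) (t₀ t : ℝ) (q : Fin n → ℝ) :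
    Function.update (i.insertNth t₀ q : Fin (n + 1) → ℝ) i t = i.insertNth t q := by
  ext j
  refine Fin.succAboveCases i ?_ (fun k => ?_) j
  · simp [Fin.insertNth_apply_same]
  · rw [Function.update_of_ne (Fin.succAbove_ne i k), Fin.insertNth_apply_succAbove, Fin.insertNth_apply_succAbove]

/-- [folklore] … and the slice functions coincide: `(t ↦ G (update (i.insertNth t₀ q) i t)) = (t ↦ G (i.insertNth t q))`. -/
theorem slice_insertNth_eq {n : ℕ} (G : (Fin (n + 1) → ℝ) → ℂ) (i : Fin (n + 1)) (t₀ : ℝ) (q : Fin n → ℝ) :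
    (fun t : ℝ => G (Function.update (i.insertNth t₀ q : Fin (n + 1) → ℝ) i t)) = fun t : ℝ => G (i.insertNth t q) := by
  funext t; rw [update_insertNth]

end Summit.QuantumFields.BalabanUV.Beta.FP.MaxwellSymbolDeriv

end
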